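import Summits.ResolutionOfSingularities.ResolutionOfSingularities.Theorems.PurelyInseparableDim4ResCone
import HarnessLib
import HarnessLib.Audit.Tags

/-!
# Purely inseparable four-folds — the TWO-SLOT GAME of class A∞(T): a letter change freezes the chart
# (cell `res-dim4-pi`, K2(p) lane, slice B brick K24a, part α: the pure combinatorics)

[OURS · counted 0 · cell `res-dim4-pi` · K2(p) lane (holder res-dim4-p-12 g3, «p-1 takes K24a» 2026-08-29
01:14Z); spec of record = res-dim4-idea-4 g3's hand proof (bus 00:38:54Z, HANDOFF-g3 §10, CANDIDATE) · seat
res-dim4-p-1 g3.]  Nothing here proves K2(p)/K2(5), `NoIsolatedTrap p p` or resolution of singularities in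
dimension ≥ 4 / characteristic `p`.  AI kernel work, weaker than expert review.

THE GAME (idea-4, A∞(T), `p = 5`, `d = 3`, `e_G ≡ 3`, two playable boundary letters `λ, μ`, a passive one
`ν`, the contact coordinate `v̄`; pair-merged presentation `G = x_λx_μ·S₀ + v̄·x_λx_μ·S₁ + v̄³·U` in the
Tschirnhaus jet frame).  Along the tail every step is a pure corner in chart `λ` or `μ`, and the frame
readings `s m (a,b,c) = coeff_{x_λ^a x_μ^b x_ν^c} S₀` / `t m (a,b,c)` of `S₁` at time `m` obey:
RELABELING (`λ`-step: `(a,b,c) ↦ (a+b+c−2, b, c)` on `S₀`; `μ`-step: `(a,b,c) ↦ (a, a+b+c−2, c)`),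
LEGALITY (a `λ`-step needs `S₀ ∌ x_λx_μ`, a `μ`-step needs `S₀ ∌ x_μ², x_λx_μ, x_μx_ν` and `S₁ ∌ x_μ`), and the
`μ`-AXIS FLAG after a `λ`-step (isolation: one of the six candidate witnesses `x_μ², x_λx_μ, x_μx_ν,
x_λx_μ², x_λx_μ³ ∈ S₀`, `x_μ ∈ S₁` is present).  This file is the COMBINATORIAL CORE only — the readings
are abstract functions `s t : ℕ → ℕ → ℕ → ℕ → K` and the axioms are hypotheses (only the instances the
argument uses); part β (frame readings) and part γ (chain assembly + free-tail theorem) discharge them.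

* **`twoSlot_letterChange_freezes`** — after a letter change `λ` (time `k`) → `μ` (time `k+1`) every step
  from `k + 2` on is a `λ`-step and `x_λx_μ² ∈ S₀` for ever (the flag at `k+1` forces `x_λx_μ³ ∈ S₀(k+1)`,
  the `μ`-step makes it `x_λx_μ²`, which is `λ`-fixed and turns any later `μ`-step into `x_λx_μ`, illegal
  for both letters).
* **`twoSlot_eventually_constant`** — hence the chart is eventually constant.

[cite: CossartJannsenSaito2020, Thm. 3.14] [cite: Hauser2010, §§F–G]
bears_on: LADDER-RESOLUTION:D157-DOOR2 (res-dim4-pi · K2(p) · slice B · K24a-α).  Supports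
stmt-ResolutionOfSingularities-16155 (helper).
-/

set_option linter.dupNamespace false -- mandated namespace of this single-conjunct summit

namespace Summit.ResolutionOfSingularities.ResolutionOfSingularities.Theorems.PIDim4

namespace ResCone

variable {K : Type} [Field K]

/-- **THE LETTER CHANGE FREEZES THE CHART** (two-slot game of A∞(T), idea-4's three-step argument).
Readings `s m a b c` (of `S₀`) and `t m a b c` (of `S₁`) at time `m`, `L m` = «step `m` is a `λ`-step»
(otherwise a `μ`-step); hypotheses = the instances of RELABELING / LEGALITY / FLAG the argument reads.
If step `k` is `λ` and step `k + 1` is `μ`, then every step `m ≥ k + 2` is `λ` and `s m 1 2 0 ≠ 0`.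
[OURS · hand proof res-dim4-idea-4 g3] [folklore] -/
theorem twoSlot_letterChange_freezes {s t : ℕ → ℕ → ℕ → ℕ → K} {L : ℕ → Prop}
    (hfix : ∀ m, L m → s (m + 1) 1 2 0 = s m 1 2 0)
    (hmuA : ∀ m, ¬ L m → s (m + 1) 1 1 0 = s m 1 2 0)
    (hmuB : ∀ m, ¬ L m → s (m + 1) 1 2 0 = s m 1 3 0)
    (hlegL : ∀ m, L m → s m 1 1 0 = 0)
    (hlegM : ∀ m, ¬ L m → s m 0 2 0 = 0 ∧ s m 1 1 0 = 0 ∧ s m 0 1 1 = 0 ∧ t m 0 1 0 = 0)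
    (hflag : ∀ m, L m → s (m + 1) 0 2 0 ≠ 0 ∨ s (m + 1) 1 1 0 ≠ 0 ∨ s (m + 1) 0 1 1 ≠ 0 ∨
      s (m + 1) 1 2 0 ≠ 0 ∨ s (m + 1) 1 3 0 ≠ 0 ∨ t (m + 1) 0 1 0 ≠ 0)
    {k : ℕ} (hk : L k) (hk1 : ¬ L (k + 1)) :
    ∀ m, k + 2 ≤ m → L m ∧ s m 1 2 0 ≠ 0 := by
  -- `x_λ x_μ ∈ S₀` is illegal for both letters
  have hkill : ∀ m, s m 1 1 0 ≠ 0 → False := fun m h => by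
    by_cases hL : L m
    · exact h (hlegL m hL)
    · exact h (hlegM m hL).2.1
  -- a `μ`-step on `x_λ x_μ² ∈ S₀` is fatal one step later
  have hstay : ∀ m, s m 1 2 0 ≠ 0 → L m := fun m h => by
    by_contra hL
    exact hkill (m + 1) (by rw [hmuA m hL]; exact h)
  -- the flag at `k + 1` leaves only `x_λ x_μ³`
  have h130 : s (k + 1) 1 3 0 ≠ 0 := by
    obtain ⟨h020, h110, h011, h010⟩ := hlegM (k + 1) hk1
    rcases hflag k hk with h | h | h | h | h | h
    · exact absurd h020 h
    · exact absurd h110 h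
    · exact absurd h011 h
    · exact (hkill (k + 2) (by rw [hmuA (k + 1) hk1]; exact h)).elim
    · exact h
    · exact absurd h010 h
  have h120 : s (k + 2) 1 2 0 ≠ 0 := by rw [hmuB (k + 1) hk1]; exact h130
  intro m hm
  induction m, hm using Nat.le_induction with
  | base => exact ⟨hstay _ h120, h120⟩
  | succ m hm ih =>
    have h' : s (m + 1) 1 2 0 ≠ 0 := by rw [hfix m ih.1]; exact ih.2
    exact ⟨hstay _ h', h'⟩

/-- **THE TWO-SLOT CHART IS EVENTUALLY CONSTANT**: under the same readings, from some index on either every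
step is a `λ`-step or every step is a `μ`-step (so the tail is a constant-chart — FREE — tail, which the
free-tail theorem forbids for isolated chains; part γ). [OURS · hand proof res-dim4-idea-4 g3] [folklore] -/
theorem twoSlot_eventually_constant {s t : ℕ → ℕ → ℕ → ℕ → K} {L : ℕ → Prop}
    (hfix : ∀ m, L m → s (m + 1) 1 2 0 = s m 1 2 0)
    (hmuA : ∀ m, ¬ L m → s (m + 1) 1 1 0 = s m 1 2 0)
    (hmuB : ∀ m, ¬ L m → s (m + 1) 1 2 0 = s m 1 3 0)
    (hlegL : ∀ m, L m → s m 1 1 0 = 0)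
    (hlegM : ∀ m, ¬ L m → s m 0 2 0 = 0 ∧ s m 1 1 0 = 0 ∧ s m 0 1 1 = 0 ∧ t m 0 1 0 = 0)
    (hflag : ∀ m, L m → s (m + 1) 0 2 0 ≠ 0 ∨ s (m + 1) 1 1 0 ≠ 0 ∨ s (m + 1) 0 1 1 ≠ 0 ∨
      s (m + 1) 1 2 0 ≠ 0 ∨ s (m + 1) 1 3 0 ≠ 0 ∨ t (m + 1) 0 1 0 ≠ 0) :
    ∃ N, (∀ m, N ≤ m → L m) ∨ (∀ m, N ≤ m → ¬ L m) := by
  by_cases hchange : ∃ k, L k ∧ ¬ L (k + 1)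
  · obtain ⟨k, hk, hk1⟩ := hchange
    exact ⟨k + 2, Or.inl fun m hm =>
      (twoSlot_letterChange_freezes hfix hmuA hmuB hlegL hlegM hflag hk hk1 m hm).1⟩
  · push Not at hchange
    by_cases hsome : ∃ k, L k
    · obtain ⟨k, hk⟩ := hsome
      refine ⟨k, Or.inl fun m hm => ?_⟩
      induction m, hm using Nat.le_induction with
      | base => exact hk
      | succ m _ ih => exact hchange m ih
    · push Not at hsome
      exact ⟨0, Or.inr fun m _ => hsome m⟩

end ResCone

end Summit.ResolutionOfSingularities.ResolutionOfSingularities.Theorems.PIDim4
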